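import Summits.Langlands.Langlands.Theorems.TwinRigiditySplit
import Summits.Langlands.Langlands.Theorems.TwinRigiditySplitRegular
import Literature.NumberTheory.Automorphic.ReciprocityGLnDescentProofs
import Literature.NumberTheory.Automorphic.ClassFieldCharacterLocal
import Literature.NumberTheory.GaloisRepresentations.FrobeniusDensityTheorem

/-!
# `PhaseTwistSplitPrelude` — lens-4 g30 node `PhaseTwistSplit`, landing part 1/2: the pieces PAR / IMP (+ companion STRONG, family PAR(n)), the places lemmas and
# THE DICTIONARY `powCompatible_of_relAvatar` (relative avatar along a Galois layer ⟹ `[L:K]`-power avatar over `K`).  0 sorry.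

Part 2 (`Theorems/PhaseTwistSplit.lean`) holds the kernel (`closes_target : PAR → IMP → TatePhantomLift.PerfectLayerRigidity` BY NAME, `closes_item` = the route item
stmt-Langlands-27355 BY NAME, exactness `rigid_iff_strong_imp`, `par_of_langlands` modulo the typed print fact [Patankar–Rajan 2010], host edges).  The full mechanism /
novelty / weaker-than-S discussion is the module docstring of part 2 (= the node card HOME/decomp-langlands-lens-4/g30/PhaseTwistSplit.md on the decomp-langlands bus).
-/


set_option linter.dupNamespace false
set_option linter.style.longLine false

noncomputable section

namespace Summit.Langlands.Langlands.Theorems.PhaseTwistSplit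

open scoped BigOperators Topology Matrix Classical NumberField Polynomial
open Filter Set Function
open Polynomial (X C)
open Literature.NumberTheory.GaloisRepresentations Literature.NumberTheory.Automorphic
open IsDedekindDomain
open Summit.Langlands.Langlands.Theses
open Summit.Langlands.Langlands.Theses.GaloisHullLift
open Summit.Langlands.Langlands.Theorems.TatePhantomLift
open Summit.Langlands.Langlands.Theorems.TwinRigiditySplit

/-! ## §0 The pieces (binder prefixes are literal copies of RIGID's) -/

/-- **PAR · NEW · LATERAL (layer-free) · S-implied mod [Patankar–Rajan 2010, Thm 2 + Cor 1] · UNDECIDED ((A)-hard in the irregular regime) ·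
INSTRUMENTABLE** — power-avatar descent («phases are coherent»): a semisimple `ρ₀ : Γ_K → GL_n(ℚ̄_ℓ)` irreducible on every finite layer whose
`e`-th Frobenius powers have, at almost every place, the characteristic polynomial predicted by the `e`-th powers of the Satake parameters of the
L-algebraic cuspidal `π` is, up to a twist by a continuous character `χ` of `Γ_K` (under S: of finite order, a «phase»), Satake–Frobenius compatible with `π`
almost everywhere.
Why it might fail: for `e ≥ 2` it produces an avatar of `π` from Galois-side data alone — in the irregular regime this is as inaccessible as (A);
strong irreducibility is necessary (`Ind σ ⊗ μ` is a power avatar of `AI(σ)` without being a twist of `Ind σ` by a character of `Γ_K`).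
Sources: Patankar–Rajan arXiv:1010.5393 (Thm 2, Cor 1, Thm 1); Rajan arXiv:math/0207308; Ramakrishnan, Ann. Math. 152 (2000). -/
def PowerAvatarDescent : Prop :=
  ∀ (K : Type) [Field K] [NumberField K] (n : ℕ) (hcpt : Literature.NumberTheory.Automorphic.isCompact_glFiniteIntegralLevel n K), 0 < n → ∀ (π : Literature.NumberTheory.Automorphic.CuspidalAutomorphicRepData n K hcpt), π.1.IsLAlgebraic → ∀ (ℓ : ℕ) [Fact ℓ.Prime] (ι : PadicAlgCl ℓ ≃+* ℂ) (ρ₀ : Literature.NumberTheory.GaloisRepresentations.FramedGaloisRep K (PadicAlgCl ℓ) n), ρ₀.toGaloisRep.IsSemisimple → (∀ (M : Type) [Field M] [NumberField M] [Algebra K M], (ρ₀.restrictField M).IsIrreducible) → ∀ (e : ℕ), 0 < e → (∀ᶠ v : IsDedekindDomain.HeightOneSpectrum (NumberField.RingOfIntegers K) in cofinite, ∀ α : Multiset ℂ, π.1.HasSatakeParamAt v α → ρ₀.IsUnramifiedAt v ∧ ∀ 𝔓 ∈ v.primesAbove, ∀ σ : Field.absoluteGaloisGroup K, IsArithFrobAt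 (NumberField.RingOfIntegers K) σ 𝔓 → Literature.NumberTheory.GaloisRepresentations.FramedRep.charpoly ρ₀ (σ ^ e) = Literature.NumberTheory.Automorphic.arithFrobPolyOfSatake ι (v.residueCard ^ e) 1 (α.map (fun a => a ^ e))) → ∃ χ : Field.absoluteGaloisGroup K →ₜ* (PadicAlgCl ℓ)ˣ, ∀ᶠ v : IsDedekindDomain.HeightOneSpectrum (NumberField.RingOfIntegers K) in cofinite, SatakeFrobCompatibleAt ι π.1 (Literature.NumberTheory.GaloisRepresentations.FramedRep.twist ρ₀ χ) v

/-- **IMP · WEAKER (restriction of RIGID; `imp_of_rigid`) · S-implied (`imp_of_langlands`) · UNDECIDED · rank-reducing cell** — RIGID for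
candidates `ρ₀` that become REDUCIBLE on some finite layer `M/K` (then `r|Γ_{LM}` is reducible: `r` is imprimitive or potentially isotypic, all
constituents of rank `< n`).  Why it might fail: it does not if Langlands holds; open — the natural inputs (reciprocity in rank `< n` for the
constituents + automorphic induction / isobaric descent) are themselves open in the irregular regime. -/
def ImprimitiveCandidateRigidity : Prop :=
  ∀ (K : Type) [Field K] [NumberField K] (n : ℕ) (hcpt : Literature.NumberTheory.Automorphic.isCompact_glFiniteIntegralLevel n K), 0 < n → ∀ (π : Literature.NumberTheory.Automorphic.CuspidalAutomorphicRepData n K hcpt), π.1.IsLAlgebraic → ∀ (L : Type) [Field L] [NumberField L] [Algebra K L], IsGalois K L → Module.finrank K L ≠ 1 → (¬ ∃ F : IntermediateField K L, F ≠ ⊥ ∧ IsGalois K ↥F ∧ IsCyclic (↥F ≃ₐ[K] ↥F) ∧ (Module.finrank K ↥F).Prime) → ∀ (ℓ : ℕ) [Fact ℓ.Prime] (ι : PadicAlgCl ℓ ≃+* ℂ) (r : Literature.NumberTheory.GaloisRepresentations.FramedGaloisRep L (PadicAlgCl ℓ) n), r.toGaloisRep.IsSemisimple → r.IsIrreducible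 → (∃ ρ₀ : Literature.NumberTheory.GaloisRepresentations.FramedGaloisRep K (PadicAlgCl ℓ) n, ρ₀.toGaloisRep.IsSemisimple ∧ (¬ ∀ (M : Type) [Field M] [NumberField M] [Algebra K M], (ρ₀.restrictField M).IsIrreducible) ∧ (∀ᶠ w : IsDedekindDomain.HeightOneSpectrum (NumberField.RingOfIntegers L) in cofinite, ∀ (v : IsDedekindDomain.HeightOneSpectrum (NumberField.RingOfIntegers K)) (α : Multiset ℂ), w.asIdeal.under (NumberField.RingOfIntegers K) = v.asIdeal → π.1.HasSatakeParamAt v α → (ρ₀.restrictField L).IsUnramifiedAt w ∧ (ρ₀.restrictField L).HasFrobCharpolyAt w (Literature.NumberTheory.Automorphic.arithFrobPolyOfSatake ι w.residueCard 1 (α.map (fun a => a ^ w.asIdeal.inertiaDeg (NumberField.RingOfIntegers K)))))) → (∀ᶠ w : IsDedekindDomain.HeightOneSpectrum (NumberField.RingOfIntegers L) in cofinite, ∀ (v : IsDedekindDomain.HeightOneSpectrum (NumberField.RingOfIntegers K)) (α : Multiset ℂ), w.asIdeal.under (NumberField.RingOfIntegers K) = v.asIdeal → π.1.HasSatakeParamAt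 v α → r.IsUnramifiedAt w ∧ r.HasFrobCharpolyAt w (Literature.NumberTheory.Automorphic.arithFrobPolyOfSatake ι w.residueCard 1 (α.map (fun a => a ^ w.asIdeal.inertiaDeg (NumberField.RingOfIntegers K))))) → ∃ ρ : Literature.NumberTheory.GaloisRepresentations.FramedGaloisRep K (PadicAlgCl ℓ) n, ρ.toGaloisRep.IsSemisimple ∧ ∀ᶠ v : IsDedekindDomain.HeightOneSpectrum (NumberField.RingOfIntegers K) in cofinite, SatakeFrobCompatibleAt ι π.1 ρ v

/-- **STRONG · COMPANION (exactness bookkeeping only; not a piece of the cut) · WEAKER (restriction of RIGID) · S-implied · PAR-implied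
(`strong_of_par`)** — RIGID for candidates irreducible on every finite layer.  `RIGID ⟺ STRONG ∧ IMP` (`rigid_iff_strong_imp`). -/
def StrongCandidateRigidity : Prop :=
  ∀ (K : Type) [Field K] [NumberField K] (n : ℕ) (hcpt : Literature.NumberTheory.Automorphic.isCompact_glFiniteIntegralLevel n K), 0 < n → ∀ (π : Literature.NumberTheory.Automorphic.CuspidalAutomorphicRepData n K hcpt), π.1.IsLAlgebraic → ∀ (L : Type) [Field L] [NumberField L] [Algebra K L], IsGalois K L → Module.finrank K L ≠ 1 → (¬ ∃ F : IntermediateField K L, F ≠ ⊥ ∧ IsGalois K ↥F ∧ IsCyclic (↥F ≃ₐ[K] ↥F) ∧ (Module.finrank K ↥F).Prime) → ∀ (ℓ : ℕ) [Fact ℓ.Prime] (ι : PadicAlgCl ℓ ≃+* ℂ) (r : Literature.NumberTheory.GaloisRepresentations.FramedGaloisRep L (PadicAlgCl ℓ) n), r.toGaloisRep.IsSemisimple → r.IsIrreducible → (∃ ρ₀ : Literature.NumberTheory.GaloisRepresentations.FramedGaloisRep K (PadicAlgCl ℓ) n, ρ₀.toGaloisRep.IsSemisimple ∧ (∀ (M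 : Type) [Field M] [NumberField M] [Algebra K M], (ρ₀.restrictField M).IsIrreducible) ∧ (∀ᶠ w : IsDedekindDomain.HeightOneSpectrum (NumberField.RingOfIntegers L) in cofinite, ∀ (v : IsDedekindDomain.HeightOneSpectrum (NumberField.RingOfIntegers K)) (α : Multiset ℂ), w.asIdeal.under (NumberField.RingOfIntegers K) = v.asIdeal → π.1.HasSatakeParamAt v α → (ρ₀.restrictField L).IsUnramifiedAt w ∧ (ρ₀.restrictField L).HasFrobCharpolyAt w (Literature.NumberTheory.Automorphic.arithFrobPolyOfSatake ι w.residueCard 1 (α.map (fun a => a ^ w.asIdeal.inertiaDeg (NumberField.RingOfIntegers K)))))) → (∀ᶠ w : IsDedekindDomain.HeightOneSpectrum (NumberField.RingOfIntegers L) in cofinite, ∀ (v : IsDedekindDomain.HeightOneSpectrum (NumberField.RingOfIntegers K)) (α : Multiset ℂ), w.asIdeal.under (NumberField.RingOfIntegers K) = v.asIdeal → π.1.HasSatakeParamAt v α → r.IsUnramifiedAt w ∧ r.HasFrobCharpolyAt w (Literature.NumberTheory.Automorphic.arithFrobPolyOfSatake ι w.residueCard 1 (α.map (fun a => a ^ w.asIdeal.inertiaDeg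 (NumberField.RingOfIntegers K))))) → ∃ ρ : Literature.NumberTheory.GaloisRepresentations.FramedGaloisRep K (PadicAlgCl ℓ) n, ρ.toGaloisRep.IsSemisimple ∧ ∀ᶠ v : IsDedekindDomain.HeightOneSpectrum (NumberField.RingOfIntegers K) in cofinite, SatakeFrobCompatibleAt ι π.1 ρ v

/-- PAR as a family in the rank `n` (node-local; `par_iff_forall`), so that rank slices are literal. -/
def PowerAvatarDescentAt (n : ℕ) : Prop :=
  ∀ (K : Type) [Field K] [NumberField K] (hcpt : Literature.NumberTheory.Automorphic.isCompact_glFiniteIntegralLevel n K), 0 < n → ∀ (π : Literature.NumberTheory.Automorphic.CuspidalAutomorphicRepData n K hcpt), π.1.IsLAlgebraic → ∀ (ℓ : ℕ) [Fact ℓ.Prime] (ι : PadicAlgCl ℓ ≃+* ℂ) (ρ₀ : Literature.NumberTheory.GaloisRepresentations.FramedGaloisRep K (PadicAlgCl ℓ) n), ρ₀.toGaloisRep.IsSemisimple → (∀ (M : Type) [Field M] [NumberField M] [Algebra K M], (ρ₀.restrictField M).IsIrreducible) → ∀ (e : ℕ), 0 < e → (∀ᶠ v : IsDedekindDomain.HeightOneSpectrum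 (NumberField.RingOfIntegers K) in cofinite, ∀ α : Multiset ℂ, π.1.HasSatakeParamAt v α → ρ₀.IsUnramifiedAt v ∧ ∀ 𝔓 ∈ v.primesAbove, ∀ σ : Field.absoluteGaloisGroup K, IsArithFrobAt (NumberField.RingOfIntegers K) σ 𝔓 → Literature.NumberTheory.GaloisRepresentations.FramedRep.charpoly ρ₀ (σ ^ e) = Literature.NumberTheory.Automorphic.arithFrobPolyOfSatake ι (v.residueCard ^ e) 1 (α.map (fun a => a ^ e))) → ∃ χ : Field.absoluteGaloisGroup K →ₜ* (PadicAlgCl ℓ)ˣ, ∀ᶠ v : IsDedekindDomain.HeightOneSpectrum (NumberField.RingOfIntegers K) in cofinite, SatakeFrobCompatibleAt ι π.1 (Literature.NumberTheory.GaloisRepresentations.FramedRep.twist ρ₀ χ) v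

/-- `PowerAvatarDescent` is the conjunction of its rank slices. -/
theorem par_iff_forall : PowerAvatarDescent ↔ ∀ n, PowerAvatarDescentAt n :=
  ⟨fun h n K _ _ => h K n, fun h K _ _ n => h n K⟩

/-! ## §1 Places: almost all `w` ⟹ almost all `v` with all `w ∣ v`; a place above; `[L:K] > 0` (0 sorry, Mathlib + Literature bookkeeping) -/

section Places

variable {K L : Type} [Field K] [NumberField K] [Field L] [NumberField L] [Algebra K L]

omit [NumberField K] [NumberField L] in
/-- A cofinite condition on the places of `L` holds, for almost every place `v` of `K`, at EVERY place `w ∣ v` (the bad `v` are the images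
of the finitely many bad `w`). [folklore] -/
theorem eventually_forall_over {Q : HeightOneSpectrum (𝓞 L) → Prop} (h : ∀ᶠ w : HeightOneSpectrum (𝓞 L) in cofinite, Q w) :
    ∀ᶠ v : HeightOneSpectrum (𝓞 K) in cofinite, ∀ w : HeightOneSpectrum (𝓞 L), w.asIdeal.under (𝓞 K) = v.asIdeal → Q w := by
  rw [Filter.eventually_cofinite] at h ⊢
  refine (h.image fun w : HeightOneSpectrum (𝓞 L) => w.under (𝓞 K)).subset fun v hv => ?_
  have hv' : ∃ w : HeightOneSpectrum (𝓞 L), w.asIdeal.under (𝓞 K) = v.asIdeal ∧ ¬ Q w := by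
    by_contra hne
    exact hv fun w hw => by_contra fun hQ => hne ⟨w, hw, hQ⟩
  obtain ⟨w, hw, hQ⟩ := hv'
  exact ⟨w, hQ, HeightOneSpectrum.ext hw⟩

omit [NumberField L] in
variable (L) in
/-- There is a finite place of `L` above every finite place of `K` (lying over, Mathlib `Ideal.exists_maximal_ideal_liesOver_of_isIntegral`). [folklore] -/
theorem exists_over (v : HeightOneSpectrum (𝓞 K)) : ∃ w : HeightOneSpectrum (𝓞 L), w.asIdeal.under (𝓞 K) = v.asIdeal := by
  haveI : v.asIdeal.IsMaximal := v.isMaximal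
  obtain ⟨Q, hQ, hQv⟩ := Ideal.exists_maximal_ideal_liesOver_of_isIntegral (S := 𝓞 L) v.asIdeal
  exact ⟨⟨Q, hQ.isPrime, Ideal.ne_bot_of_liesOver_of_ne_bot v.ne_bot Q⟩, hQv.over.symm⟩

/-- `[L:K] ≥ 1`. [folklore] -/
theorem finrank_pos' : 0 < Module.finrank K L := by
  haveI : FiniteDimensional K L := Module.Finite.of_restrictScalars_finite ℚ K L
  exact Module.finrank_pos

/-- **`f(w|v) ∣ [L:K]`** at a place unramified in the Galois extension `L/K`: the decomposition group of `w` has `e·f = f` elements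
(tree `HeightOneSpectrum.card_stabilizer_algEquiv`) inside a group of order `[L:K]` (local copy of tree `inertiaDeg_dvd_finrank_of_isUnramifiedIn`,
kept out of the import closure).  Cassels–Fröhlich VII §1.2. [folklore] -/
theorem inertiaDeg_dvd_finrank [IsGalois K L] {v : HeightOneSpectrum (𝓞 K)} (hv : Algebra.IsUnramifiedIn (𝓞 L) v.asIdeal)
    {w : HeightOneSpectrum (𝓞 L)} (hw : w.asIdeal.under (𝓞 K) = v.asIdeal) :
    w.asIdeal.inertiaDeg (𝓞 K) ∣ Module.finrank K L := by
  classical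
  haveI : FiniteDimensional K L := Module.Finite.of_restrictScalars_finite ℚ K L
  have hwu : w.under (𝓞 K) = v := HeightOneSpectrum.ext hw
  have hstab : Nat.card (MulAction.stabilizer (L ≃ₐ[K] L) w) = w.asIdeal.inertiaDeg (𝓞 K) := by
    rw [Literature.NumberTheory.Automorphic.HeightOneSpectrum.card_stabilizer_algEquiv K L w, hwu,
      ramificationIdxIn_eq_one_of_isUnramifiedIn hv, one_mul, ← inertiaDeg_eq_inertiaDegIn hw]
  rw [← hstab, ← IsGalois.card_aut_eq_finrank K L]
  exact Subgroup.card_subgroup_dvd_card _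

end Places

/-! ## §2 The dictionary: a relative avatar along a Galois layer is an `[L:K]`-power avatar over `K` (0 sorry) -/

section Dictionary

variable {K L : Type} [Field K] [NumberField K] [Field L] [NumberField L] [Algebra K L]
  {n : ℕ} {hcpt : isCompact_glFiniteIntegralLevel n K} {ℓ : ℕ} [Fact ℓ.Prime]

/-- Equal products of linear factors have equal root multisets (Mathlib `roots_multiset_prod_X_sub_C`). [folklore] -/
theorem multiset_eq_of_prod_X_sub_C_eq {A : Type*} [CommRing A] [IsDomain A] {s t : Multiset A}
    (h : (s.map fun a => X - C a).prod = (t.map fun a => X - C a).prod) : s = t := by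
  have h' := congrArg Polynomial.roots h
  rwa [Polynomial.roots_multiset_prod_X_sub_C, Polynomial.roots_multiset_prod_X_sub_C] at h'

/-- **Uniqueness of the Frobenius polynomial** (local copy of tree `FramedGaloisRep.HasFrobCharpolyAt.unique`, kept out of the import closure):
there is a prime of `ℤ̄_K` above `v` and an arithmetic Frobenius at it.  Serre 1968, I §2.1. [folklore] -/
theorem frobCharpoly_unique {F : Type} [Field F] [NumberField F] {m : ℕ} {v : HeightOneSpectrum (𝓞 F)} {ρ : FramedGaloisRep F (PadicAlgCl ℓ) m}
    {P Q : Polynomial (PadicAlgCl ℓ)} (hP : ρ.HasFrobCharpolyAt v P) (hQ : ρ.HasFrobCharpolyAt v Q) : P = Q := by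
  obtain ⟨𝔓, h𝔓⟩ := v.primesAbove_nonempty
  obtain ⟨σ, hσ⟩ := HeightOneSpectrum.exists_isArithFrobAt_of_mem_primesAbove_holds h𝔓
  rw [← hP 𝔓 h𝔓 σ hσ, ← hQ 𝔓 h𝔓 σ hσ]

/-- **At an unramified place, the characteristic polynomial of any arithmetic Frobenius is the Frobenius polynomial** (local copy of tree
`FramedGaloisRep.IsUnramifiedAt.hasFrobCharpolyAt_charpoly`).  Serre 1968, I §2.1. [folklore] -/
theorem hasFrobCharpolyAt_charpoly_of_isUnramifiedAt {v : HeightOneSpectrum (𝓞 K)} {ρ : FramedGaloisRep K (PadicAlgCl ℓ) n}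
    (h : ρ.IsUnramifiedAt v) {𝔓 : Ideal (absIntegers (𝓞 K) K)} (h𝔓 : 𝔓 ∈ v.primesAbove) {g : Field.absoluteGaloisGroup K}
    (hg : IsArithFrobAt (𝓞 K) g 𝔓) : ρ.HasFrobCharpolyAt v (FramedRep.charpoly ρ g) := by
  have hQ : ρ.HasFrobCharpolyAt v (ρ.toGaloisRep g).charpoly :=
    (FramedGaloisRep.hasFrobCharpolyAt_toGaloisRep_iff v _ ρ).mp
      (((FramedGaloisRep.isUnramifiedAt_toGaloisRep_iff v ρ).mpr h).hasFrobCharpolyAt_charpoly h𝔓 hg)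
  rw [hQ 𝔓 h𝔓 g hg]
  exact hQ

/-- `arithFrobPolyOfSatake ι q m α` is the product of `X − b` over its roots (tree `roots_arithFrobPolyOfSatake`). [folklore] -/
theorem arithFrobPolyOfSatake_eq_prod_roots (ι : PadicAlgCl ℓ ≃+* ℂ) (q m : ℕ) (α : Multiset ℂ) :
    arithFrobPolyOfSatake ι q m α = ((arithFrobPolyOfSatake ι q m α).roots.map fun b => X - C b).prod := by
  conv_lhs => rw [← (IsAlgClosed.splits (arithFrobPolyOfSatake ι q m α)).eq_prod_roots_of_monic
    (by rw [arithFrobPolyOfSatake]; exact Polynomial.monic_multiset_prod_of_monic _ _ fun _ _ => Polynomial.monic_X_sub_C _) |>.symm]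

/-- **Frobenius polynomial of a power**: if `ρ` has the predicted polynomial `arithFrobPolyOfSatake ι q_v 1 α` at `v`, then for every
arithmetic Frobenius `σ` at a prime above `v`, `charpoly ρ(σ^e) = arithFrobPolyOfSatake ι (q_v^e) 1 (α^e)` (roots raised to the `e`-th power,
`Matrix.charpoly_pow_eq_prod_of_charpoly_eq_prod`, `arithFrobPolyOfSatake_pow`).  In particular an avatar is an `e`-power avatar for every `e`. [folklore] -/
theorem charpoly_pow_of_hasFrobCharpolyAt (ι : PadicAlgCl ℓ ≃+* ℂ) {ρ : FramedGaloisRep K (PadicAlgCl ℓ) n}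
    {v : HeightOneSpectrum (𝓞 K)} {α : Multiset ℂ} (hch : ρ.HasFrobCharpolyAt v (arithFrobPolyOfSatake ι v.residueCard 1 α))
    {𝔓 : Ideal (absIntegers (𝓞 K) K)} (h𝔓 : 𝔓 ∈ v.primesAbove) {σ : Field.absoluteGaloisGroup K} (hσ : IsArithFrobAt (𝓞 K) σ 𝔓) (e : ℕ) :
    FramedRep.charpoly ρ (σ ^ e) = arithFrobPolyOfSatake ι (v.residueCard ^ e) 1 (α.map (fun a => a ^ e)) := by
  haveI : IsAlgClosed (PadicAlgCl ℓ) := AlgebraicClosure.isAlgClosed _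
  have h1 := hch 𝔓 h𝔓 σ hσ
  rw [arithFrobPolyOfSatake_eq_prod_roots] at h1
  unfold FramedRep.charpoly at h1 ⊢
  rw [map_pow, Units.val_pow_eq_pow_val, Matrix.charpoly_pow_eq_prod_of_charpoly_eq_prod _ h1 e, arithFrobPolyOfSatake_pow,
    Multiset.map_map]
  rfl

/-- **THE DICTIONARY.**  Let `L/K` be finite Galois and `ρ₀ : Γ_K → GL_n(ℚ̄_ℓ)` a framed representation whose restriction to `Γ_L` is a
relative avatar of `π` (unramified with the base-changed Satake prediction at almost every `w`).  Then for almost every place `v` of `K`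
carrying a Satake parameter `α`, `ρ₀` is unramified at `v` and `charpoly ρ₀(φ^e) = arithFrobPolyOfSatake ι (q_v^e) 1 (α^e)` for EVERY
arithmetic Frobenius `φ` at every prime above `v`, where `e = [L:K]`.  Proof: discard the finitely many `v` ramified in `L` or below a bad `w`;
unramifiedness descends from `Γ_L` (`FramedGaloisRep.isUnramifiedAt_of_restrictField`, Neukirch I (9.6)); write `charpoly ρ₀(φ) = ∏ (X − s)`
(ℚ̄_ℓ is algebraically closed); at a place `w ∣ v`, `Frob_w = φ^{f}` up to inertia gives `charpoly ρ₀|_L(Frob_w) = ∏ (X − s^f)`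
(`FramedGaloisRep.hasFrobCharpolyAt_restrictField`), the hypothesis gives `∏ (X − t^f)` with `t` the predicted roots at `v`
(`arithFrobPolyOfSatake_pow`, `q_w = q_v^f`), uniqueness of the Frobenius polynomial equates them, so `{s^f} = {t^f}`; as `f ∣ e`
(`inertiaDeg_dvd_finrank`, Cassels–Fröhlich VII §1.2) `{s^e} = {t^e}`, and `charpoly ρ₀(φ^e) = ∏ (X − s^e)`
(`Matrix.charpoly_pow_eq_prod_of_charpoly_eq_prod`). [folklore] -/
theorem powCompatible_of_relAvatar [IsGalois K L] (π : AutomorphicRepData (AutomorphyDatum.gl n K hcpt)) (ι : PadicAlgCl ℓ ≃+* ℂ)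
    (ρ₀ : FramedGaloisRep K (PadicAlgCl ℓ) n)
    (h₀ : ∀ᶠ w : HeightOneSpectrum (𝓞 L) in cofinite, ∀ (v : HeightOneSpectrum (𝓞 K)) (α : Multiset ℂ),
      w.asIdeal.under (𝓞 K) = v.asIdeal → π.HasSatakeParamAt v α →
        (ρ₀.restrictField L).IsUnramifiedAt w ∧ (ρ₀.restrictField L).HasFrobCharpolyAt w
          (arithFrobPolyOfSatake ι w.residueCard 1 (α.map (fun a => a ^ w.asIdeal.inertiaDeg (𝓞 K))))) :
    ∀ᶠ v : HeightOneSpectrum (𝓞 K) in cofinite, ∀ α : Multiset ℂ, π.HasSatakeParamAt v α →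
      ρ₀.IsUnramifiedAt v ∧ ∀ 𝔓 ∈ v.primesAbove, ∀ σ : Field.absoluteGaloisGroup K, IsArithFrobAt (𝓞 K) σ 𝔓 →
        FramedRep.charpoly ρ₀ (σ ^ Module.finrank K L) =
          arithFrobPolyOfSatake ι (v.residueCard ^ Module.finrank K L) 1 (α.map (fun a => a ^ Module.finrank K L)) := by
  haveI : IsAlgClosed (PadicAlgCl ℓ) := AlgebraicClosure.isAlgClosed _
  filter_upwards [eventually_forall_over (K := K) h₀,
    Filter.eventually_cofinite.2 (finite_setOf_not_isUnramifiedIn K L)] with v hall hunr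
  intro α hα
  have he1 : v.asIdeal.ramificationIdxIn (𝓞 L) = 1 := ramificationIdxIn_eq_one_of_isUnramifiedIn hunr
  have hur : ρ₀.IsUnramifiedAt v :=
    ρ₀.isUnramifiedAt_of_restrictField (M := L) he1 fun w hw => (hall w hw v α hw hα).1
  refine ⟨hur, fun 𝔓 h𝔓 σ hσ => ?_⟩
  -- the Frobenius polynomial of `ρ₀` at `v` and its roots `s`
  have hPv : ρ₀.HasFrobCharpolyAt v (FramedRep.charpoly ρ₀ σ) := hasFrobCharpolyAt_charpoly_of_isUnramifiedAt hur h𝔓 hσ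
  have hmon : (FramedRep.charpoly ρ₀ σ).Monic := by unfold FramedRep.charpoly; exact Matrix.charpoly_monic _
  have hPs : FramedRep.charpoly ρ₀ σ = ((FramedRep.charpoly ρ₀ σ).roots.map fun a => X - C a).prod :=
    (IsAlgClosed.splits _).eq_prod_roots_of_monic hmon
  set s := (FramedRep.charpoly ρ₀ σ).roots with hs_def
  -- a place `w ∣ v`; its residue degree divides `e = [L:K]`
  obtain ⟨w, hw⟩ := exists_over L v
  have hfe : w.asIdeal.inertiaDeg (𝓞 K) ∣ Module.finrank K L := inertiaDeg_dvd_finrank hunr hw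
  -- at `w`: the Frobenius polynomial of `ρ₀|Γ_L` computed two ways
  have hPv' : ρ₀.HasFrobCharpolyAt v ((s.map fun a => X - C a).prod) := by rw [← hPs]; exact hPv
  have h1 : (ρ₀.restrictField L).HasFrobCharpolyAt w ((s.map fun a => X - C (a ^ w.asIdeal.inertiaDeg (𝓞 K))).prod) :=
    ρ₀.hasFrobCharpolyAt_restrictField hw hur hPv'
  have h2 := (hall w hw v α hw hα).2
  have h12 := frobCharpoly_unique h1 h2
  rw [residueCard_eq_residueCard_pow_inertiaDeg hw, arithFrobPolyOfSatake_pow] at h12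
  set t := (arithFrobPolyOfSatake ι v.residueCard 1 α).roots with ht_def
  have hst : s.map (fun a => a ^ w.asIdeal.inertiaDeg (𝓞 K)) = t.map (fun a => a ^ w.asIdeal.inertiaDeg (𝓞 K)) := by
    apply multiset_eq_of_prod_X_sub_C_eq
    simp only [Multiset.map_map, Function.comp_def] at h12 ⊢
    exact h12
  obtain ⟨k, hk⟩ := hfe
  have hse : s.map (fun a => a ^ Module.finrank K L) = t.map (fun a => a ^ Module.finrank K L) := by
    have h3 := congrArg (Multiset.map fun a : PadicAlgCl ℓ => a ^ k) hst
    simp only [Multiset.map_map, Function.comp_def, ← pow_mul] at h3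
    rw [hk]
    exact h3
  -- conclude: `charpoly ρ₀(σ^e) = ∏ (X − s^e) = ∏ (X − t^e) = arithFrobPolyOfSatake ι (q^e) 1 (α^e)`
  have hL : FramedRep.charpoly ρ₀ (σ ^ Module.finrank K L) = (s.map fun a => X - C (a ^ Module.finrank K L)).prod := by
    have hPs'' : (((ρ₀ σ : GL (Fin n) (PadicAlgCl ℓ)) : Matrix (Fin n) (Fin n) (PadicAlgCl ℓ))).charpoly =
        (s.map fun a => X - C a).prod := hPs
    unfold FramedRep.charpoly
    rw [map_pow, Units.val_pow_eq_pow_val]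
    exact Matrix.charpoly_pow_eq_prod_of_charpoly_eq_prod _ hPs'' _
  rw [hL, arithFrobPolyOfSatake_pow, ← ht_def, ← hse, Multiset.map_map]
  rfl

end Dictionary

end Summit.Langlands.Langlands.Theorems.PhaseTwistSplit
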